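import Literature.MathematicalPhysics.QuantumFieldTheory.Balaban1985CMP102.SectBRestricted

/-!
# Bałaban CMP 102 (1985) 255–275, AS-PRINTED SPINE — `SectBRestrictedLaw`: the restricted densities of `SectBRestricted`
# ON EVENTS (`∫_B ρ^res_k dV = ∫_{Ū^k ∈ B} ρ₀·goodChi_k dU`), the almost-everywhere MONOTONICITY of the renormalization
# transformation `T` of (2) in its push-forward reading, `ρ^res_k ≤ ρ_k` a.e., and (47) as printed a.e. from the
# restricted lower bound — an ADDENDUM file (siblings byte-stable; dot-notation extensions of `SectB.TowerObjects`)

Source: T. Bałaban, *Ultraviolet stability of three-dimensional lattice pure gauge field theories*, Commun. Math. Phys.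
**102** (1985) 255–275 [Balaban1985UV3] ([B10]); [4] = [Balaban1985Averaging] (CMP 98), (10) p. 19 «ρ′(V) = ∫dU δ(VŪ^{−1})
ρ(U)».

WHAT THIS FILE ADDS (cell `ym3-torus`, seat p1 gen 2; companion of `SectBRestricted.lean` / `SectBRemainder.lean`).  PROVED
bookkeeping in the push-forward reading `Setup.IsRT`/`RTOpI` of (2), nothing of the paper asserted:
§L1 `measurable_iter'` (the `k`-fold averaging is measurable when each step is).
§L2 `setIntegral_rhoRes` — the good-event law ON SETS: for measurable `B`, `∫_B ρ^res_k dV = ∫_{Ū^k ∈ B} ρ₀·Π_{j≤k}χ^{δ_j}(Ū^j) dU`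
    (`integral_rhoRes_mul` at an indicator) — the form the cell's K1/K2 nodes consume (at `B = univ`: `SectBRestricted.integral_rhoRes`).
§L3 `rt_mono_ae` — a renormalization transformation (`Setup.RTOpI`: push-forward identity on integrable densities +
    positivity) is MONOTONE `dV`-a.e. on integrable densities with integrable images (tested against indicators,
    `ae_le_of_forall_setIntegral_le`); `rhoRes_le_rho_ae` — `ρ^res_k ≤ ρ_k` a.e. (the mechanism of print's (47): the dropped
    large-field contributions are nonnegative), under the integrability package; `ineq47Literal_ae_of_restricted` — (47)
    p. 267 with print's own `χ_k`, `dV`-a.e., from `Ineq47Restricted` + the inclusion «(47)-domain ⊆ δ_k-domain» (the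
    pointwise `SectBLowerBound.Ineq47Literal` needs the pointwise `ρ^res ≤ ρ`, `SectBRestricted.ineq47Literal_of_restricted`;
    `RTOpI`'s images are determined only a.e., so the a.e. form is what the push-forward reading supports).
§L4 (appended) `Ineq41RestrictedAE` / `Ineq47RestrictedAE` — the a.e. forms of the restricted readings (the shape a
    construction with a.e.-defined `T` can inhabit; cell TARGET v2 P1-7), `sandwich_ae_of_inclusion`, `rhoRes_ae_dichotomy`.
-/

namespace Literature.MathematicalPhysics.QuantumFieldTheory.Balaban1985CMP102.SectB.TowerObjects

open Literature.MathematicalPhysics.QuantumFieldTheory.Balaban1983to89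
open Literature.MathematicalPhysics.QuantumFieldTheory.Balaban1985CMP102.Setting
open _root_.MeasureTheory

variable {L : ℕ} {S : Scales L} {G : Type} [Balaban1983to89.GaugeGroup G] [MeasurableSpace G]
  [Balaban1983to89.HaarData G] (W : TowerObjects S G)

/-! ## §L1 Plumbing: the iterated averaging map is measurable -/

omit [Balaban1983to89.HaarData G] in
/-- The `k`-fold averaging map `Ū^k = Averaging.iter av k` is measurable when every one-step averaging is (the lane's
binder C-2 / [4] (15) smooth); cf. LQB `T4Continuum.measurable_iter`, re-derived to keep the spine's imports light.
[cite: Balaban1985Averaging, (10) p.19] -/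
theorem measurable_iter' {av : ∀ j, Balaban1983to89.Averaging S.P j G} (hav : ∀ j, Measurable (av j).avg) :
    ∀ k : ℕ, Measurable (Balaban1983to89.Averaging.iter av k)
  | 0 => measurable_id
  | k + 1 => (hav k).comp (measurable_iter' hav k)

/-! ## §L2 The push-forward identity on EVENTS: restricted masses of sets -/

/-- `∫ f·𝟙_s = ∫_s f` (plumbing). [folklore] -/
private theorem integral_mul_indicator_one {α : Type*} [MeasurableSpace α] (μ : Measure α) (f : α → ℝ) {s : Set α}
    (hs : MeasurableSet s) : ∫ x, f x * s.indicator (fun _ => (1 : ℝ)) x ∂μ = ∫ x in s, f x ∂μ := by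
  rw [← integral_indicator hs]
  congr 1
  funext x
  by_cases hx : x ∈ s <;> simp [Set.indicator, hx]

/-- `∫ f·𝟙_s∘φ = ∫_{φ⁻¹'s} f` (plumbing). [folklore] -/
private theorem integral_mul_indicator_one_comp {α β : Type*} [MeasurableSpace α] (μ : Measure α) (f : α → ℝ)
    (φ : α → β) {s : Set β} (hs : MeasurableSet (φ ⁻¹' s)) :
    ∫ x, f x * s.indicator (fun _ => (1 : ℝ)) (φ x) ∂μ = ∫ x in φ ⁻¹' s, f x ∂μ := by
  rw [← integral_indicator hs]
  congr 1
  funext x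
  by_cases hx : φ x ∈ s <;> simp [Set.indicator, hx]


/-- **THE GOOD-EVENT LAW ON SETS**: for every measurable set `B` of level-`k` fields, `∫_B ρ^res_k dV = ∫_{Ū^k ∈ B}
ρ₀·Π_{j≤k}χ^{δ_j}(Ū^j) dU` — `integral_rhoRes_mul` at the indicator of `B`; the form in which the cell's K1/K2 nodes read
the law of the averaged field on the good event («the `ρ₀ dU`-mass of the fine fields whose `j`-fold averages are all
`δ_j`-small and whose `k`-fold average lies in `B`»). [cite: Balaban1985UV3, (2) p.256 + (40)–(41) p.266; Balaban1985Averaging, (10) p.19] -/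
theorem setIntegral_rhoRes [Balaban1983to89.RegularGaugeGroup G] (δ : ℕ → ℝ)
    (hav : ∀ j, Measurable (W.av j).avg)
    (hint : ∀ j, Integrable (W.rhoRes δ j) (Balaban1983to89.fieldMeasure S.P j G)) (k : ℕ)
    {B : Set (Balaban1983to89.GaugeField S.P k G)} (hB : MeasurableSet B) :
    ∫ V in B, W.rhoRes δ k V ∂(Balaban1983to89.fieldMeasure S.P k G)
      = ∫ U in (Balaban1983to89.Averaging.iter W.av k) ⁻¹' B, W.rho0 U * W.goodChi δ k U
          ∂(Balaban1983to89.fieldMeasure S.P 0 G) := by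
  have hbd : ∀ V : Balaban1983to89.GaugeField S.P k G, |B.indicator (fun _ => (1 : ℝ)) V| ≤ 1 := by
    intro V
    by_cases hV : V ∈ B <;> simp [Set.indicator, hV]
  have h := W.integral_rhoRes_mul δ hav hint k (B.indicator fun _ => (1 : ℝ)) (measurable_const.indicator hB) ⟨1, hbd⟩
  rw [integral_mul_indicator_one _ _ hB,
    integral_mul_indicator_one_comp _ _ _ (hB.preimage (measurable_iter' hav k))] at h
  exact h

/-! ## §L3 `T` is monotone almost everywhere; `ρ^res_k ≤ ρ_k` almost everywhere -/

/-- **A RENORMALIZATION TRANSFORMATION IS MONOTONE ALMOST EVERYWHERE** (push-forward reading of (2), [4] (10) p. 19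
«ρ′(V) = ∫dU δ(VŪ^{−1}) ρ(U)» with `dU` a product of Haar measures — a positive linear operation): if `ρ ≤ ρ'` `dU`-a.e.
(integrable densities with integrable `T`-images, measurable averaging), then `Tρ ≤ Tρ'` `dV`-a.e.  Proved from
`Setup.IsRT` tested against indicators (`ae_le_of_forall_setIntegral_le`); `Setup.RTOpI` itself records only positivity,
and its `T`-images are determined only `dV`-a.e., so the a.e. form is the right one. [cite: Balaban1985Averaging, (10) p.19] -/
theorem rt_mono_ae {j : ℕ} {av : Balaban1983to89.Averaging S.P j G} (T : Balaban1983to89.RTOpI S.P j G av)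
    (havg : Measurable av.avg) {ρ ρ' : Balaban1983to89.Density S.P j G}
    (hρ : Integrable ρ (Balaban1983to89.fieldMeasure S.P j G))
    (hρ' : Integrable ρ' (Balaban1983to89.fieldMeasure S.P j G))
    (hT : Integrable (T.T ρ) (Balaban1983to89.fieldMeasure S.P (j + 1) G))
    (hT' : Integrable (T.T ρ') (Balaban1983to89.fieldMeasure S.P (j + 1) G))
    (hle : ρ ≤ᵐ[Balaban1983to89.fieldMeasure S.P j G] ρ') :
    T.T ρ ≤ᵐ[Balaban1983to89.fieldMeasure S.P (j + 1) G] T.T ρ' := by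
  refine ae_le_of_forall_setIntegral_le hT hT' fun s hs _ => ?_
  have hbd : ∃ C : ℝ, ∀ V : Balaban1983to89.GaugeField S.P (j + 1) G, |s.indicator (fun _ => (1 : ℝ)) V| ≤ C :=
    ⟨1, fun V => by by_cases hV : V ∈ s <;> simp [Set.indicator, hV]⟩
  have hmeas : Measurable (s.indicator fun _ => (1 : ℝ)) := measurable_const.indicator hs
  have e1 := T.isRT ρ hρ _ hmeas hbd
  have e2 := T.isRT ρ' hρ' _ hmeas hbd
  rw [integral_mul_indicator_one _ _ hs, integral_mul_indicator_one_comp _ _ _ (hs.preimage havg)] at e1 e2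
  rw [e1, e2]
  exact setIntegral_mono_ae hρ.integrableOn hρ'.integrableOn hle

/-- `ρ_{k+1} = T_k ρ_k` ((2) p. 256; definitional for `RunObjects.rho`). [cite: Balaban1985UV3, (2) p.256] -/
theorem rho_succ (k : ℕ) : W.rho (k + 1) = (W.T k).T (W.rho k) := rfl

/-- `ρ_0 = ρ₀` ((1) p. 256; definitional). [cite: Balaban1985UV3, (1) p.256] -/
theorem rho_zero : W.rho 0 = W.rho0 := rfl

/-- **THE RESTRICTED DENSITY LIES BELOW THE FULL ONE, almost everywhere**: `ρ^res_k ≤ ρ_k` `dV`-a.e. — dropping the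
nonnegative large-field contributions (the mechanism of print's lower bound (47), p. 272 L32–33), given integrability
of the densities involved (restricted ones, their `T`-images, and the `ρ_j` of (2)) and measurable averaging.  By
induction: `ρ^res_{k+1} = χ·T(ρ^res_k) ≤ T(ρ^res_k) ≤ᵐ T(ρ_k) = ρ_{k+1}` (`rt_mono_ae`). [cite: Balaban1985UV3, (2) p.256 + (47) p.267 + p.272 L32–33] -/
theorem rhoRes_le_rho_ae (δ : ℕ → ℝ) (hav : ∀ j, Measurable (W.av j).avg)
    (hint : ∀ j, Integrable (W.rhoRes δ j) (Balaban1983to89.fieldMeasure S.P j G))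
    (hintT : ∀ j, Integrable ((W.T j).T (W.rhoRes δ j)) (Balaban1983to89.fieldMeasure S.P (j + 1) G))
    (hintρ : ∀ j, Integrable (W.rho j) (Balaban1983to89.fieldMeasure S.P j G)) :
    ∀ k : ℕ, W.rhoRes δ k ≤ᵐ[Balaban1983to89.fieldMeasure S.P k G] W.rho k
  | 0 => ae_of_all _ fun U => by
      rw [rhoRes_zero, rho_zero]
      have h0 : 0 ≤ W.rho0 U := by unfold RunObjects.rho0; exact Real.exp_nonneg _
      exact mul_le_of_le_one_left h0 (chiAll_le_one 0 (δ 0) U)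
  | k + 1 => by
      have ih := rhoRes_le_rho_ae δ hav hint hintT hintρ k
      have hT : (W.T k).T (W.rhoRes δ k) ≤ᵐ[Balaban1983to89.fieldMeasure S.P (k + 1) G] W.rho (k + 1) := by
        rw [rho_succ]
        exact rt_mono_ae (W.T k) (hav k) (hint k) (hintρ k) (hintT k) (by rw [← rho_succ]; exact hintρ (k + 1)) ih
      have hχ : W.rhoRes δ (k + 1) ≤ᵐ[Balaban1983to89.fieldMeasure S.P (k + 1) G] (W.T k).T (W.rhoRes δ k) :=
        ae_of_all _ fun V => by
          rw [rhoRes_succ]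
          exact mul_le_of_le_one_left ((W.T k).pos _ (W.rhoRes_nonneg δ k) V) (chiAll_le_one (k + 1) (δ (k + 1)) V)
      exact hχ.trans hT

/-- **(47) AS PRINTED, almost everywhere, from the restricted lower bound**: under `Ineq47Restricted`, the inclusion
«(47)-domain ⊆ δ_k-domain» and the integrability package of `rhoRes_le_rho_ae`, print's (47) p. 267 L17–20 with its own
`χ_k` holds `dV`-a.e. (the pointwise `SectBLowerBound.Ineq47Literal` needs the pointwise `ρ^res ≤ ρ`,
`ineq47Literal_of_restricted`). [cite: Balaban1985UV3, (47) p.267] -/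
theorem ineq47Literal_ae_of_restricted (δ : ℕ → ℝ) (k : ℕ) (h : W.Ineq47Restricted δ k)
    (hincl : ∀ V, W.Chi47Restriction k V → Balaban1983to89.PlaqSmall (δ k) V)
    (hav : ∀ j, Measurable (W.av j).avg)
    (hint : ∀ j, Integrable (W.rhoRes δ j) (Balaban1983to89.fieldMeasure S.P j G))
    (hintT : ∀ j, Integrable ((W.T j).T (W.rhoRes δ j)) (Balaban1983to89.fieldMeasure S.P (j + 1) G))
    (hintρ : ∀ j, Integrable (W.rho j) (Balaban1983to89.fieldMeasure S.P j G)) :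
    ∀ᵐ V ∂(Balaban1983to89.fieldMeasure S.P k G),
      W.chi47 k V * Real.exp (W.explicitExpo k V - W.Ecst k - W.Rm k) ≤ W.rho k V := by
  filter_upwards [W.rhoRes_le_rho_ae δ hav hint hintT hintρ k] with V hV
  by_cases hc : W.Chi47Restriction k V
  · have h1 : chiAll k (δ k) V = 1 := (chiAll_eq_one_iff k (δ k) V).2 (hincl V hc)
    have h2 := h V
    rw [h1, mul_one] at h2
    exact h2.trans hV
  · rw [(W.chi47_eq_zero_iff k V).2 hc, zero_mul]
    exact (W.rhoRes_nonneg δ k V).trans hV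


/-! ## §L4 Almost-everywhere forms of the restricted readings — the shape a CONSTRUCTION can inhabit (appended, cell
`ym3-torus` seat p1 gen 2, TARGET v2 P1-7): the lane pub-balaban3d's transformations `T` are Radon–Nikodym transports
(`AveragingRT.rnTransport`), determined `dV`-a.e. only, and its booked one-step residuals R3D-01 `Fibre49` / R3D-02
`Fibre57Low` (`Summits/…/Balaban3D/Proofs/Bound55Std`) are `≤ᵐ` statements; a reduction «(α) inputs ⇒ restricted readings»
can therefore only land in the following a.e. forms, which the K1-S consumer (a domination of MEASURES) does not
distinguish from the pointwise ones -/

/-- **The restricted reading of (41), `dV`-almost everywhere** (hypothesis-shaped, never asserted; the pointwise form is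
`SectBRestricted.Ineq41Restricted`): `ρ^res_k ≤ χ^{δ_k}·exp[F − E_k + Rm_k]` for `dV`-a.e. `V`. [cite: Balaban1985UV3, (41) p.266] -/
def Ineq41RestrictedAE (δ : ℕ → ℝ) (k : ℕ) : Prop :=
  ∀ᵐ V ∂(Balaban1983to89.fieldMeasure S.P k G),
    W.rhoRes δ k V ≤ chiAll k (δ k) V * Real.exp (W.explicitExpo k V - W.Ecst k + W.Rm k)

/-- **The restricted reading of (47), `dV`-almost everywhere** (hypothesis-shaped, never asserted; the pointwise form is
`SectBRestricted.Ineq47Restricted`): `χ_k·χ^{δ_k}·exp[F − E_k − Rm_k] ≤ ρ^res_k` for `dV`-a.e. `V`. [cite: Balaban1985UV3, (47) p.267] -/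
def Ineq47RestrictedAE (δ : ℕ → ℝ) (k : ℕ) : Prop :=
  ∀ᵐ V ∂(Balaban1983to89.fieldMeasure S.P k G),
    W.chi47 k V * chiAll k (δ k) V * Real.exp (W.explicitExpo k V - W.Ecst k - W.Rm k) ≤ W.rhoRes δ k V

/-- Pointwise ⇒ a.e. (bookkeeping). [cite: Balaban1985UV3, (41) p.266] -/
theorem ineq41RestrictedAE_of_restricted (δ : ℕ → ℝ) (k : ℕ) (h : W.Ineq41Restricted δ k) :
    W.Ineq41RestrictedAE δ k :=
  ae_of_all _ h

/-- Pointwise ⇒ a.e. (bookkeeping). [cite: Balaban1985UV3, (47) p.267] -/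
theorem ineq47RestrictedAE_of_restricted (δ : ℕ → ℝ) (k : ℕ) (h : W.Ineq47Restricted δ k) :
    W.Ineq47RestrictedAE δ k :=
  ae_of_all _ h

/-- **THE SANDWICH, `dV`-a.e., from the a.e. readings and the threshold inclusion** (the a.e. twin of
`SectBRestricted.sandwich_of_inclusion`): for `dV`-a.e. `V`, if `V` is `δ_k`-small then `e^{−E_k − Rm_k}·e^{F(V)} ≤ ρ^res_k(V) ≤
e^{−E_k + Rm_k}·e^{F(V)}` — enough for a two-sided domination of the MEASURE `ρ^res_k dV` against `𝟙_{δ_k-small}e^{F} dV`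
(constant `e^{−E_k}`, log-radius `Rm_k`). [cite: Balaban1985UV3, (41) p.266 + (47) p.267] -/
theorem sandwich_ae_of_inclusion (δ : ℕ → ℝ) (k : ℕ) (h41 : W.Ineq41RestrictedAE δ k) (h47 : W.Ineq47RestrictedAE δ k)
    (hincl : ∀ V, Balaban1983to89.PlaqSmall (δ k) V → W.Chi47Restriction k V) :
    ∀ᵐ V ∂(Balaban1983to89.fieldMeasure S.P k G), Balaban1983to89.PlaqSmall (δ k) V →
      Real.exp (-W.Ecst k - W.Rm k) * Real.exp (W.explicitExpo k V) ≤ W.rhoRes δ k V ∧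
        W.rhoRes δ k V ≤ Real.exp (-W.Ecst k + W.Rm k) * Real.exp (W.explicitExpo k V) := by
  filter_upwards [h41, h47] with V hu hl hδ
  have h1 : chiAll k (δ k) V = 1 := (chiAll_eq_one_iff k (δ k) V).2 hδ
  have h2 : W.chi47 k V = 1 := (W.chi47_eq_one_iff k V).2 (hincl V hδ)
  rw [h1, one_mul] at hu
  rw [h1, h2, one_mul, one_mul] at hl
  constructor
  · rw [← Real.exp_add]
    convert hl using 2
    ring
  · rw [← Real.exp_add]
    convert hu using 2
    ring

/-- Off the `δ_k`-small domain `ρ^res_k` vanishes identically (`SectBRestricted.rhoRes_eq_zero_of_not_small`), so the a.e.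
sandwich describes the measure `ρ^res_k dV` completely: for `dV`-a.e. `V`, EITHER `V` is not `δ_k`-small and `ρ^res_k(V) = 0`,
OR the two-sided bound holds.  Bookkeeping. [cite: Balaban1985UV3, (41) p.266 + (47) p.267] -/
theorem rhoRes_ae_dichotomy (δ : ℕ → ℝ) (k : ℕ) (h41 : W.Ineq41RestrictedAE δ k) (h47 : W.Ineq47RestrictedAE δ k)
    (hincl : ∀ V, Balaban1983to89.PlaqSmall (δ k) V → W.Chi47Restriction k V) :
    ∀ᵐ V ∂(Balaban1983to89.fieldMeasure S.P k G),
      (¬ Balaban1983to89.PlaqSmall (δ k) V ∧ W.rhoRes δ k V = 0) ∨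
      (Balaban1983to89.PlaqSmall (δ k) V ∧
        Real.exp (-W.Ecst k - W.Rm k) * Real.exp (W.explicitExpo k V) ≤ W.rhoRes δ k V ∧
        W.rhoRes δ k V ≤ Real.exp (-W.Ecst k + W.Rm k) * Real.exp (W.explicitExpo k V)) := by
  filter_upwards [W.sandwich_ae_of_inclusion δ k h41 h47 hincl] with V hV
  by_cases hδ : Balaban1983to89.PlaqSmall (δ k) V
  · exact Or.inr ⟨hδ, hV hδ⟩
  · exact Or.inl ⟨hδ, W.rhoRes_eq_zero_of_not_small δ k V hδ⟩

end Literature.MathematicalPhysics.QuantumFieldTheory.Balaban1985CMP102.SectB.TowerObjects
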